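import Literature.NumberTheory.GaloisRepresentations.ImaginaryQuadraticCyclotomicProofs
import HarnessLib

/-!
# X3, the DEGENERATE rows OFF the sub-locus: an element of `ℚ̄` FIXED BY THE STABILISER OF AN
# ALGEBRAIC INTEGER `a` is a rational polynomial in `a` (cell `bsd-eis`, seat `bsd-eis-x3` gen 7; the
# fixed-field half of STEP 3 of the independence argument F5 for the layer T-side classes, MEMO-9
# §2.4 (f): with `a = ζ₉`, «`γ'` fixed by `G₁ ∩ Stab(ζ₃) = Stab(ζ₉)` ⟹ `γ' ∈ ℚ(ζ₉)`»; route K1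
# `AdditiveBranchIMC`, crux `GordTwoRankZeroOffCaseOne` — supports only)

HONEST FRAMING (`run/shared/lean/pub/bsd-eis/README.md` §4): THEOREMS ONLY (no `def`, no named fact,
no `sorry`); nothing is booked; no label, tier or count of record moves.

* `exists_aeval_of_forall_smul_eq` — Krull–Galois for `ℚ̄/ℚ` (`InfiniteGalois.fixedField_fixingSubgroup`,
  `Rat.isGalois_algebraicClosure` for the `ℚ`-algebra diamond)
  at the simple extension `ℚ⟮a⟯`: if every `σ ∈ Γ_ℚ` with `σa = a` fixes `x`, then `x = G(a)` for some
  `G ∈ ℚ[X]`.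
References: [NeukirchANT1999] Ch. IV §1 (Krull topology, infinite Galois correspondence).
-/

set_option autoImplicit false

noncomputable section

namespace Summit.BirchSwinnertonDyer.Rank1Residual.Additive

namespace KummerLayerTwisted

open Field Polynomial IntermediateField
  Literature.NumberTheory.GaloisRepresentations

/-- **Fixed by the stabiliser of `a` ⟹ a rational polynomial in `a`.** `a ∈ ℚ̄` integral over `ℚ`,
`x ∈ ℚ̄` with `σx = x` for every `σ ∈ Γ_ℚ` fixing `a`: then `x = G(a)` for some `G ∈ ℚ[X]`
(`x ∈ Fix(Fix(ℚ⟮a⟯)) = ℚ⟮a⟯ = ℚ[a]`). [cite: NeukirchANT1999, Ch. IV §1] -/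
theorem exists_aeval_of_forall_smul_eq {a x : AlgebraicClosure ℚ} (ha : IsIntegral ℚ a)
    (hx : ∀ σ : absoluteGaloisGroup ℚ, σ • a = a → σ • x = x) :
    ∃ G : ℚ[X], x = aeval a G := by
  haveI : IsGalois ℚ (AlgebraicClosure ℚ) := Rat.isGalois_algebraicClosure
  set E : IntermediateField ℚ (AlgebraicClosure ℚ) := ℚ⟮a⟯ with hE
  -- `x` is fixed by the fixing subgroup of `E = ℚ⟮a⟯`
  have hxfix : x ∈ IntermediateField.fixedField E.fixingSubgroup := by
    rw [IntermediateField.mem_fixedField_iff]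
    intro f hf
    have hfa : f a = a := (IntermediateField.mem_fixingSubgroup_iff _ _).mp hf a
      (mem_adjoin_simple_self ℚ a)
    have h := hx ((absoluteGaloisGroup.toAlgEquiv ℚ).symm f)
      (by rw [absoluteGaloisGroup.toAlgEquiv_symm_apply]; exact hfa)
    rwa [absoluteGaloisGroup.toAlgEquiv_symm_apply] at h
  rw [InfiniteGalois.fixedField_fixingSubgroup E] at hxfix
  -- `E = ℚ[a]` and its elements are values of rational polynomials at `a`
  have hmem : x ∈ E.toSubalgebra := hxfix
  rw [hE, adjoin_simple_toSubalgebra_of_isAlgebraic ha.isAlgebraic,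
    Algebra.adjoin_singleton_eq_range_aeval] at hmem
  obtain ⟨G, hG⟩ := hmem
  exact ⟨G, hG.symm⟩

end KummerLayerTwisted

end Summit.BirchSwinnertonDyer.Rank1Residual.Additive

end
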